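import Summits.KontsevichZagierPeriods.KontsevichZagierPeriods.Theorems.TypeAGeneration.Negative.SameVariablesWitness
import Summits.KontsevichZagierPeriods.KontsevichZagierPeriods.Theorems.UnfoldedStokesStokesGenerationStubSpanToReps
import Literature.Barriers.KontsevichZagierPeriods.AlgebraicPrimitivesObstruction
import Literature.NumberTheory.Transcendental.KZLogCalculusProofs

/-!
# `TypeAGeneration` (stmt-KontsevichZagierPeriods-18392) — the one-variable bridge (generic form)

cdisprove (refuter) tool for the negative lemmas on the crux `TypeAGeneration` of route
`KontsevichZagierPeriods/SymplecticScissors` (Ayoub 2015 Conj. 1.1 typed over `AyoubPeriodSeries.lean`).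
GENERIC form of the bridge of `Negative/SameVariables.lean` (which treats the one element
`1/(2+z₀) − 1/(3−z₀)`), for the room-uniform family of `Negative/SameVariablesWithRoom.lean` and any
later one-variable kernel element. Theorems only.

* `mem_kSpan_relAC_zero_of_mem_kSpan_oneVar` — in a `k`-combination of type-(a) elements
  `∂G/∂zᵢ − G|_{zᵢ=1} + G|_{zᵢ=0}` whose certificates `G` involve `z₀` only, the directions `i ≥ 1`
  may be discarded (they are `0`, `relAC_eq_zero_of_dependsOnlyOnLT_one`): only `i = 0` matters.
* `exists_semialgebraic_primitive_of_mem_kSpan_oneVar` — THE BRIDGE: if a series `F` with REAL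
  Taylor coefficients `cₙ` on the `z₀`-axis (and `0` off it), whose real germ `Σ cₙ tⁿ` sums to `h(t)`
  on `[0, 1]`, is a `ℚ`-combination of elements `∂₀G − G|_{z₀=1} + G|_{z₀=0}` with
  `G ∈ 𝒪_{ℚ-alg}(𝔻̄^∞)` in `z₀` only, then `h + C` has a `ℚ`-semialgebraic primitive on `[0, 1]` for
  some real constant `C` (the real parts of the `G`'s are `ℚ`-semialgebraic `C¹` germs on a box around
  the closed cube — `StokesGenerationLine.generator_package` —, the complex identity evaluates on the
  cube — `cube_identity` — and is read along the edge `t ↦ (t, 0, …, 0)`).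
* `no_semialgebraic_primitive_of_simple_pole` — the barrier engine repackaged: if
  `((X − x₀)·V)·(h + C) = N_C` polynomially on `(0,1)` with `V(x₀)·N_C(x₀) ≠ 0` for every `C`, no
  `h + C` has a `ℚ`-semialgebraic primitive on `[0, 1]`.

References: Ayoub, Ann. of Math. 181 (2015), Rem. 1.2; Ayoub, EMS Newsl. 91 (2014), Def. 10,
Rem. 13; Bochnak–Coste–Roy 1998, Prop. 2.2.6.
-/

noncomputable section

namespace Summit.KontsevichZagierPeriods.SymplecticScissors.TypeAGenerationNegative

open Set Finsupp
open Literature.NumberTheory.Transcendental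
open Literature.NumberTheory.Transcendental.AyoubRel
open Summit.KontsevichZagierPeriods.KontsevichZagierPeriods.StokesGenerationLine

/-! ## Only the direction `z₀` matters for one-variable certificates -/

/-- **Discarding the directions `i ≥ 1`.** A `k`-combination of type-(a) elements with certificates
in `z₀` only is a `k`-combination of elements `∂₀G − G|_{z₀=1} + G|_{z₀=0}` with `G` in `z₀` only
(replace `G` by `0` whenever `i ≥ 1`: those elements vanish). [cite: Ayoub2015, Rem. 1.2] -/
theorem mem_kSpan_relAC_zero_of_mem_kSpan_oneVar {k : Type} [Field k] (σ : k →+* ℂ) {F : CSeries}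
    (hF : F ∈ kSpan σ {x : CSeries | ∃ G ∈ Oan σ, DependsOnlyOnLT G 1 ∧ ∃ i : ℕ, x = relAC i G}) :
    F ∈ kSpan σ {x : CSeries | ∃ G ∈ Oan σ, DependsOnlyOnLT G 1 ∧ x = relAC 0 G} := by
  classical
  obtain ⟨n, cc, s, hs, hFsum⟩ := hF
  choose G hG hG1 i hsi using hs
  refine ⟨n, cc, s, fun j => ⟨if i j = 0 then G j else 0, ?_, ?_, ?_⟩, hFsum⟩
  · split_ifs
    · exact hG j
    · exact zero_mem_Oan _
  · split_ifs
    · exact hG1 j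
    · intro a _; exact map_zero _
  · by_cases hij : i j = 0
    · rw [if_pos hij, hsi j, hij]
    · rw [if_neg hij, relAC_zero, hsi j]
      exact relAC_eq_zero_of_dependsOnlyOnLT_one (hG1 j) (Nat.one_le_iff_ne_zero.mpr hij)

/-! ## The bridge -/

/-- **The one-variable bridge (generic).** Let `F ∈ ℂ[[z]]` have real Taylor coefficients `cₙ` on
the `z₀`-axis and `0` off it, with `Σ cₙ tⁿ = h(t)` on `[0, 1]`. If `F` is a `ℚ`-combination of
elements `∂₀G − G|_{z₀=1} + G|_{z₀=0}` with `G ∈ 𝒪_{ℚ-alg}(𝔻̄^∞)` in the variable `z₀` only, then for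
some real `C` the function `h + C` has a `ℚ`-semialgebraic primitive on `[0, 1]` (a `ℚ`-semialgebraic
`g` on `{x | x₀ ∈ [0,1]}` with `(g(t))' = h(t) + C` on `(0, 1)`).
[cite: Ayoub2014, Def. 10 and Rem. 13] -/
theorem exists_semialgebraic_primitive_of_mem_kSpan_oneVar {F : CSeries} {c : ℕ → ℝ} {h : ℝ → ℝ}
    (hFc : ∀ n : ℕ, MvPowerSeries.coeff (single 0 n) F = (c n : ℂ))
    (hFz : ∀ b : ℕ →₀ ℕ, (∀ n, b ≠ single 0 n) → MvPowerSeries.coeff b F = 0)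
    (hsum : ∀ t ∈ Icc (0 : ℝ) 1, HasSum (fun n : ℕ => c n * t ^ n) (h t))
    (hspan : F ∈ kSpan (algebraMap ℚ ℂ)
      {x : CSeries | ∃ G ∈ Oan (algebraMap ℚ ℂ), DependsOnlyOnLT G 1 ∧ x = relAC 0 G}) :
    ∃ (C : ℝ) (g : (Fin 1 → ℝ) → ℝ),
      IsSemialgebraicFunOn ℚ {x | x 0 ∈ Icc (0 : ℝ) 1} g ∧
      ∀ t ∈ Ioo (0 : ℝ) 1, HasDerivAt (fun s : ℝ => g (fun _ => s)) (h t + C) t := by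
  classical
  obtain ⟨J, lam, s, hs, hF⟩ := hspan
  choose G hG hG1 hsG using hs
  -- `Kⱼ = λⱼ Gⱼ ∈ 𝒪_{ℚ-alg}(𝔻̄^∞)`, in the variable `z₀`
  have hlam : ∀ j, ∃ p : Polynomial ℚ, p ≠ 0 ∧
      Polynomial.eval₂ (algebraMap ℚ ℂ) (algebraMap ℚ ℂ (lam j)) p = 0 := fun j =>
    ⟨Polynomial.X - Polynomial.C (lam j), Polynomial.X_sub_C_ne_zero _, by simp⟩
  have hK : ∀ j, (algebraMap ℚ ℂ (lam j)) • G j ∈ Oan (algebraMap ℚ ℂ) := fun j =>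
    smul_mem_Oan _ (hlam j) (hG j)
  have hK1 : ∀ j, DependsOnlyOnLT ((algebraMap ℚ ℂ (lam j)) • G j) 1 := fun j a ha => by
    rw [MvPowerSeries.coeff_smul, hG1 j a ha, mul_zero]
  choose r hr1 hrs using fun j => (hK j).2.1
  choose P hP0 hPK using fun j => (hK j).2.2
  choose V hV using fun j => exists_vars_subset_range (P j)
  -- the dimension `M ≥ 1`, past the variables of the `Pⱼ`
  obtain ⟨M, h1M, hVM⟩ : ∃ M, 1 ≤ M ∧ ∀ j, V j ≤ M := by
    refine ⟨1 + ∑ j, V j, Nat.le_add_right _ _, fun j => ?_⟩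
    have hle : V j ≤ ∑ j', V j' :=
      Finset.single_le_sum (f := fun j' => V j') (fun _ _ => Nat.zero_le _) (Finset.mem_univ j)
    omega
  have hKd : ∀ j, DependsOnlyOnLT ((algebraMap ℚ ℂ (lam j)) • G j) M := fun j => (hK1 j).mono h1M
  have hvars : ∀ j n, (↑((P j).coeff n).vars : Set ℕ) ⊆ Set.range (Fin.val : Fin M → ℕ) :=
    fun j n => hV j M (hVM j) n
  -- one package per generator
  choose ρ hρ1 hρr hsemi hC1 hderiv using
    fun j => generator_package (hr1 j) (hrs j) (hKd j) (hP0 j) (hPK j) (hvars j)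
  set i0 : Fin M := ⟨0, h1M⟩ with hi0
  set gfun : Fin J → (Fin M → ℝ) → ℝ := fun j y => ∑' a : Fin M →₀ ℕ,
    (MvPowerSeries.coeff (Finsupp.embDomain Fin.valEmbedding a)
      ((algebraMap ℚ ℂ (lam j)) • G j)).re * ∏ l, y l ^ a l with hgfun
  have hWo : ∀ j, IsOpen (Set.pi Set.univ (fun _ : Fin M => Set.Ioo (-(ρ j : ℝ)) (ρ j))) :=
    fun j => isOpen_box _
  have hcubeW : ∀ j, Set.pi Set.univ (fun _ : Fin M => Set.Icc (0:ℝ) 1) ⊆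
      Set.pi Set.univ (fun _ : Fin M => Set.Ioo (-(ρ j : ℝ)) (ρ j)) := fun j => cubePi_subset_box (hρ1 j)
  -- the edge `t ↦ (t, 0, …, 0)` of the closed cube
  have hedge : ∀ t ∈ Icc (0:ℝ) 1,
      (Pi.single i0 t : Fin M → ℝ) ∈ Set.pi Set.univ (fun _ : Fin M => Set.Icc (0:ℝ) 1) := by
    intro t ht l _
    rcases eq_or_ne l i0 with rfl | hl
    · rw [Pi.single_eq_same]; exact ht
    · rw [Pi.single_eq_of_ne hl]; exact ⟨le_rfl, zero_le_one⟩
  -- the complex identity, read on the edge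
  have hNM : 1 ≤ M := h1M
  have hHas : ∀ x ∈ Set.pi Set.univ (fun _ : Fin 1 => Set.Icc (0:ℝ) 1),
      HasSum (fun a : Fin 1 →₀ ℕ => c (a 0) * ∏ j, x j ^ a j) (h (x 0)) := by
    intro x hx
    let e : ℕ ≃ (Fin 1 →₀ ℕ) :=
      { toFun := fun n => single 0 n
        invFun := fun a => a 0
        left_inv := fun n => single_eq_same
        right_inv := fun a => Finsupp.ext fun i => by rw [Subsingleton.elim i 0, single_eq_same] }
    refine (e.hasSum_iff).mp ?_
    refine (hsum (x 0) (hx 0 (mem_univ _))).congr_fun fun n => ?_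
    simp [e]
  have hFc' : ∀ a : Fin 1 →₀ ℕ, MvPowerSeries.coeff (a.embDomain Fin.valEmbedding) F =
      ((c (a 0) : ℝ) : ℂ) := by
    intro a
    have ha : a = single 0 (a 0) := Finsupp.ext fun i => by rw [Subsingleton.elim i 0, single_eq_same]
    conv_lhs => rw [ha, embDomain_single]
    exact hFc (a 0)
  have hFz' : ∀ b : ℕ →₀ ℕ, b ∉ Set.range (Finsupp.embDomain (@Fin.valEmbedding 1)) →
      MvPowerSeries.coeff b F = 0 := by
    intro b hb
    refine hFz b fun n hn => hb ⟨single 0 n, ?_⟩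
    rw [embDomain_single, hn]
    rfl
  have hF' : F = ∑ j, relAC ((fun _ : Fin J => i0) j : ℕ) ((algebraMap ℚ ℂ (lam j)) • G j) := by
    rw [hF]
    exact Finset.sum_congr rfl fun j _ => by rw [hsG j, relAC_smul]
  have hid : ∀ t ∈ Icc (0:ℝ) 1, h t =
      ∑ j, (fderiv ℝ (gfun j) (Pi.single i0 t) (Pi.single i0 1) -
        gfun j (Pi.single i0 1) + gfun j 0) := by
    intro t ht
    have h := cube_identity (M := M) hNM (h := fun x => h (x 0)) hHas hFc' hFz'
      _ (fun _ => i0) hF' r hr1 hrs hKd (Pi.single i0 t) (hedge t ht)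
    have h0 : (Pi.single i0 t : Fin M → ℝ) (Fin.castLE hNM 0) = t := by
      have : Fin.castLE hNM 0 = i0 := Fin.ext rfl
      rw [this, Pi.single_eq_same]
    simp only [h0] at h
    rw [h]
    refine Finset.sum_congr rfl fun j _ => ?_
    rw [hderiv j _ (hcubeW j (hedge t ht)) i0]
    have hu1 : Function.update (Pi.single i0 t : Fin M → ℝ) i0 1 = Pi.single i0 1 := by
      rw [Pi.single, Function.update_idem]; rfl
    have hu0 : Function.update (Pi.single i0 t : Fin M → ℝ) i0 0 = 0 := by
      rw [Pi.single, Function.update_idem, ← Pi.single, Pi.single_zero]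
    simp only [hgfun, hu1, hu0]
  -- the real certificate `g(t) = Σⱼ gⱼ(t, 0, …, 0)`
  refine ⟨∑ j, (gfun j (Pi.single i0 1) - gfun j 0),
    fun x => ∑ j, gfun j (Pi.single i0 (x 0)), ?_, ?_⟩
  · -- semialgebraicity on `[0, 1]`
    have hS : Literature.ModelTheory.ExponentialFields.IsSemialgebraic ℚ
        {x : Fin 1 → ℝ | x 0 ∈ Icc (0 : ℝ) 1} := by
      have : {x : Fin 1 → ℝ | x 0 ∈ Icc (0 : ℝ) 1} =
          Set.pi Set.univ (fun _ : Fin 1 => Set.Icc (0:ℝ) 1) := by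
        ext x; simp only [Set.mem_setOf_eq, Set.mem_univ_pi, Fin.forall_fin_one]
      rw [this]; exact isSemialgebraic_cubePi 1
    have hφ : IsSemialgebraicMapOn ℚ {x : Fin 1 → ℝ | x 0 ∈ Icc (0 : ℝ) 1}
        (fun x => (Pi.single i0 (x 0) : Fin M → ℝ)) := by
      refine (isSemialgebraicMapOn_aeval hS
        (Pi.single i0 (MvPolynomial.X 0 : MvPolynomial (Fin 1) ℚ))).congr fun x _ => ?_
      funext l
      rcases eq_or_ne l i0 with rfl | hl
      · simp
      · simp [Pi.single_eq_of_ne hl]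
    have hmaps : ∀ j, MapsTo (fun x : Fin 1 → ℝ => (Pi.single i0 (x 0) : Fin M → ℝ))
        {x : Fin 1 → ℝ | x 0 ∈ Icc (0 : ℝ) 1}
        (Set.pi Set.univ (fun _ : Fin M => Set.Ioo (-(ρ j : ℝ)) (ρ j))) :=
      fun j x hx => hcubeW j (hedge (x 0) hx)
    refine KZ.isSemialgebraicFunOn_finset_sum Finset.univ hS fun j _ => ?_
    exact IsSemialgebraicFunOn.comp_isSemialgebraicMapOn_holds (hsemi j) hφ (hmaps j)
  · -- the derivative along the edge
    intro t ht
    have htI : t ∈ Icc (0:ℝ) 1 := Ioo_subset_Icc_self ht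
    have hpath : HasDerivAt (fun s : ℝ => (Pi.single i0 s : Fin M → ℝ))
        (Pi.single i0 (1 : ℝ) : Fin M → ℝ) t := by
      have h := (hasDerivAt_id t).smul_const (Pi.single i0 (1 : ℝ) : Fin M → ℝ)
      simp only [one_smul] at h
      refine h.congr_of_eventuallyEq (Filter.Eventually.of_forall fun s => ?_)
      show (Pi.single i0 s : Fin M → ℝ) = id s • (Pi.single i0 (1 : ℝ) : Fin M → ℝ)
      funext l
      rcases eq_or_ne l i0 with rfl | hl
      · simp
      · simp [Pi.single_eq_of_ne hl]
    have hj : ∀ j ∈ (Finset.univ : Finset (Fin J)),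
        HasDerivAt (fun s : ℝ => gfun j (Pi.single i0 s))
          (fderiv ℝ (gfun j) (Pi.single i0 t) (Pi.single i0 1)) t := by
      intro j _
      have hx : (Pi.single i0 t : Fin M → ℝ) ∈
          Set.pi Set.univ (fun _ : Fin M => Set.Ioo (-(ρ j : ℝ)) (ρ j)) := hcubeW j (hedge t htI)
      have hdiff : DifferentiableAt ℝ (gfun j) (Pi.single i0 t) :=
        ((hC1 j).differentiableOn one_ne_zero _ hx).differentiableAt ((hWo j).mem_nhds hx)
      exact hdiff.hasFDerivAt.comp_hasDerivAt t hpath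
    have hsum' := HasDerivAt.fun_sum hj
    refine hsum'.congr_deriv ?_
    have h := hid t htI
    rw [Finset.sum_add_distrib, Finset.sum_sub_distrib] at h
    rw [Finset.sum_sub_distrib]
    linarith

/-! ## The barrier engine, repackaged for a simple pole -/

open Polynomial in
/-- **No `ℚ`-semialgebraic primitive across a simple pole.** If on `(0, 1)` the function `h`
satisfies `((X − x₀)·V)(t)·(h(t) + C) = N_C(t)` for polynomials with `V(x₀) ≠ 0` and `N_C(x₀) ≠ 0`
(a simple pole at `x₀` with non-zero residue, persisting for every constant `C`), then no `h + C`
has a `ℚ`-semialgebraic primitive on `[0, 1]`: such a primitive satisfies a non-trivial polynomial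
relation (`NoSemialgPrimKernel.exists_ne_zero_evalEval_eq_zero`), which the descent
`NoSemialgPrimKernel.eq_zero_of_evalEval_eq_zero` forbids. [cite: Ayoub2015, Rem. 1.2] -/
theorem no_semialgebraic_primitive_of_simple_pole {h : ℝ → ℝ} {x₀ : ℝ} {V : ℝ[X]} (N : ℝ → ℝ[X])
    (hV : V.eval x₀ ≠ 0) (hN : ∀ C : ℝ, (N C).eval x₀ ≠ 0)
    (hDN : ∀ (C : ℝ), ∀ t ∈ Ioo (0 : ℝ) 1, ((X - Polynomial.C x₀) * V).eval t * (h t + C) = (N C).eval t)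
    (C : ℝ) (g : (Fin 1 → ℝ) → ℝ) (hg : IsSemialgebraicFunOn ℚ {x | x 0 ∈ Icc (0 : ℝ) 1} g)
    (hd : ∀ t ∈ Ioo (0 : ℝ) 1, HasDerivAt (fun s : ℝ => g (fun _ => s)) (h t + C) t) : False := by
  obtain ⟨P, hP0, hPv⟩ :=
    Literature.Barriers.KontsevichZagierPeriods.KZ.NoSemialgPrimKernel.exists_ne_zero_evalEval_eq_zero hg
  exact hP0 (Literature.Barriers.KontsevichZagierPeriods.KZ.NoSemialgPrimKernel.eq_zero_of_evalEval_eq_zero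
    (G := fun s : ℝ => g fun _ => s) hd (hDN C) hV (hN C) P.natDegree P le_rfl
    (fun t ht => hPv t (Ioo_subset_Icc_self ht)))

end Summit.KontsevichZagierPeriods.SymplecticScissors.TypeAGenerationNegative
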